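import Mathlib
import Literature.MathematicalPhysics.QuantumFieldTheory.Luscher2010.TrivializingMaps
import Literature.MathematicalPhysics.QuantumFieldTheory.Luscher2010.FlowActionSeries
import Summits.Ventures.LatticeQCDFlow.TrivializingMaps.SeriesUniqueness
import Summits.Ventures.LatticeQCDFlow.TrivializingMaps.ZeroModes
import Summits.Ventures.LatticeQCDFlow.TrivializingMaps.LoopActionSeries
import HarnessLib

/-!
# App. E's normalisation makes the Lüscher series unique on the field manifold

HONEST FRAMING: exact (Metropolis-corrected) sampling algorithms for lattice gauge theory; figures of merit are
autocorrelation/cost numbers at stated couplings and volumes; no continuum-physics claim.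

Lüscher, CMP 293 (2010) 899, §4.3 (after eq. (4.15)): the recursion determines each order `S̃^{(k)}`
"unambiguously up to an irrelevant additive constant"; App. E.2 fixes that constant by `P G φ = 0`, i.e. zero
Haar mean at `t₀ = 0` — the tree's `IsHaarNormalised` (`Literature/…/Luscher2010/FlowActionSeries.lean`, whose
docstring asserts "With this normalisation the Lüscher series is unique"). This file PROVES that assertion
for smooth ambient representatives, and identifies the normalised series of a Wilson-loop action with the
anchored construction of `LoopActionSeries`:

* `IsLuscherSeries.sub_coeConfig_eq`: two smooth solutions of the recursion for the same action differ, at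
  every order, by a CONSTANT on `SU(n)^E` (the tree's gradient uniqueness `IsLuscherSeries.linkDeriv_eq` +
  the zero-mode theorem `sub_apply_coeConfig_eq_of_linkLap_eq`);
* `IsLuscherSeries.coeConfig_eq_of_isHaarNormalised`: if both are Haar-normalised they AGREE on `SU(n)^E`
  at every order (the constant integrates to zero against the probability measure `D[U]`);
* `IsLuscherSeries.coeConfig_eq_loopSk`: hence, in `d ≥ 2`, every smooth Haar-normalised Lüscher series of
  a loop action `∑_x ∑_C Re(c_C tr U(C_x))` coincides on `SU(n)^E` with `loopSk` (any anchor direction `ν₀`),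
  order by order — so it inherits every manifold-level property of the construction (locality of gradients,
  `LoopActionGenerator`; zero mean; the constants `loopConst`).

References: M. Lüscher, CMP 293 (2010) 899 [Luscher2010Trivializing, arXiv:0907.5491], §4.2 eqs. (4.8)–(4.9),
§4.3 eqs. (4.12)–(4.15), App. E.2.
-/

namespace Summit.Ventures.LatticeQCDFlow.TrivializingMaps

open MeasureTheory
open Literature.MathematicalPhysics.QuantumFieldTheory
open Literature.MathematicalPhysics.QuantumFieldTheory.Luscher2010
open scoped Matrix Matrix.Norms.Frobenius ContDiff

noncomputable section

variable {d L n : ℕ} [NeZero L]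

/-- **Two smooth Lüscher series of the same action differ by constants on `SU(n)^E`**, order by order:
`S̃^{(k)}(ιU) - S̃'^{(k)}(ιU) = S̃^{(k)}(ι1) - S̃'^{(k)}(ι1)`. [cite: Luscher2010Trivializing, §4.3] -/
theorem IsLuscherSeries.sub_coeConfig_eq {B : SuBasis n} {S : AmbConfig d L n → ℝ}
    {Sk Sk' : ℕ → AmbConfig d L n → ℝ} {c c' : ℕ → ℝ}
    (h : IsLuscherSeries B S Sk c) (h' : IsLuscherSeries B S Sk' c')
    (hsm : ∀ k, ContDiff ℝ ∞ (Sk k)) (hsm' : ∀ k, ContDiff ℝ ∞ (Sk' k)) (k : ℕ)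
    (U : GaugeConfig d L (Matrix.specialUnitaryGroup (Fin n) ℂ)) :
    Sk k (WilsonFlow.coeConfig U) - Sk' k (WilsonFlow.coeConfig U) =
      Sk k (WilsonFlow.coeConfig fun _ => 1) - Sk' k (WilsonFlow.coeConfig fun _ => 1) := by
  refine sub_apply_coeConfig_eq_of_linkLap_eq B (hsm k) (hsm' k) (κ := c k - c' k) (fun U' => ?_) U
  cases k with
  | zero => rw [h.1 U', h'.1 U']; ring
  | succ k =>
      rw [h.2 k U', h'.2 k U']
      simp only [(IsLuscherSeries.linkDeriv_eq h h' hsm hsm' k).2]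
      ring

/-- **App. E's normalisation makes the series unique on the field manifold**: two smooth, Haar-normalised
Lüscher series of the same action agree on `SU(n)^E` at every order (and have the same constants,
`IsLuscherSeries.const_eq`). [cite: Luscher2010Trivializing, §4.3, App. E.2] -/
theorem IsLuscherSeries.coeConfig_eq_of_isHaarNormalised {B : SuBasis n} {S : AmbConfig d L n → ℝ}
    {Sk Sk' : ℕ → AmbConfig d L n → ℝ} {c c' : ℕ → ℝ}
    (h : IsLuscherSeries B S Sk c) (h' : IsLuscherSeries B S Sk' c')
    (hsm : ∀ k, ContDiff ℝ ∞ (Sk k)) (hsm' : ∀ k, ContDiff ℝ ∞ (Sk' k))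
    (hN : IsHaarNormalised Sk) (hN' : IsHaarNormalised Sk') (k : ℕ)
    (U : GaugeConfig d L (Matrix.specialUnitaryGroup (Fin n) ℂ)) :
    Sk k (WilsonFlow.coeConfig U) = Sk' k (WilsonFlow.coeConfig U) := by
  set δ : ℝ := Sk k (WilsonFlow.coeConfig fun _ => 1) - Sk' k (WilsonFlow.coeConfig fun _ => 1) with hδdef
  have hδ : ∀ U' : GaugeConfig d L (Matrix.specialUnitaryGroup (Fin n) ℂ),
      Sk k (WilsonFlow.coeConfig U') - Sk' k (WilsonFlow.coeConfig U') = δ :=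
    fun U' => IsLuscherSeries.sub_coeConfig_eq h h' hsm hsm' k U'
  have hi : Integrable (fun U' : GaugeConfig d L (Matrix.specialUnitaryGroup (Fin n) ℂ) =>
      Sk k (WilsonFlow.coeConfig U')) (trivialMeasure (Matrix.specialUnitaryGroup (Fin n) ℂ) d L) :=
    integrable_trivialMeasure_of_continuous ((hsm k).continuous.comp WilsonFlow.continuous_coeConfig)
  have hi' : Integrable (fun U' : GaugeConfig d L (Matrix.specialUnitaryGroup (Fin n) ℂ) =>
      Sk' k (WilsonFlow.coeConfig U')) (trivialMeasure (Matrix.specialUnitaryGroup (Fin n) ℂ) d L) :=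
    integrable_trivialMeasure_of_continuous ((hsm' k).continuous.comp WilsonFlow.continuous_coeConfig)
  have h0 : ∫ U', (Sk k (WilsonFlow.coeConfig U') - Sk' k (WilsonFlow.coeConfig U'))
      ∂(trivialMeasure (Matrix.specialUnitaryGroup (Fin n) ℂ) d L) = 0 := by
    rw [integral_sub hi hi', hN k, hN' k, sub_zero]
  have h1 : ∫ U', (Sk k (WilsonFlow.coeConfig U') - Sk' k (WilsonFlow.coeConfig U'))
      ∂(trivialMeasure (Matrix.specialUnitaryGroup (Fin n) ℂ) d L) = δ := by
    simp_rw [hδ]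
    rw [integral_const]
    simp
  have hδ0 : δ = 0 := by rw [← h1, h0]
  have hU := hδ U
  rw [hδ0, sub_eq_zero] at hU
  exact hU

/-- **The normalised Lüscher series of a loop action is the anchored construction** (`d ≥ 2`): every smooth,
Haar-normalised solution of the recursion for `S = ∑_x ∑_C Re(c_C tr U(C_x))` coincides on `SU(n)^E` with
`loopSk` (for any anchor direction `ν₀`), order by order. [cite: Luscher2010Trivializing, §4.3, §4.5(b), App. E.2] -/
theorem IsLuscherSeries.coeConfig_eq_loopSk {d : ℕ} (hd : 2 ≤ d) (B : SuBasis n) (shapes : Finset (PathWord d))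
    (coef : PathWord d → ℂ) (ν₀ : Fin d) (L : ℕ) [NeZero L] {Sk : ℕ → AmbConfig d L n → ℝ} {c : ℕ → ℝ}
    (h : IsLuscherSeries B (loopAction shapes coef) Sk c) (hsm : ∀ k, ContDiff ℝ ∞ (Sk k))
    (hN : IsHaarNormalised Sk) (k : ℕ) (U : GaugeConfig d L (Matrix.specialUnitaryGroup (Fin n) ℂ)) :
    Sk k (WilsonFlow.coeConfig U) = loopSk hd B shapes coef ν₀ L k (WilsonFlow.coeConfig U) :=
  IsLuscherSeries.coeConfig_eq_of_isHaarNormalised h (isLuscherSeries_loopSk hd B shapes coef ν₀ L) hsm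
    (contDiff_loopSk hd B shapes coef ν₀ L) hN (isHaarNormalised_loopSk hd B shapes coef ν₀ L) k U

/-- In particular the anchored construction does not depend on the anchor direction on `SU(n)^E`.
[folklore] -/
theorem loopSk_coeConfig_eq_of_dir {d : ℕ} (hd : 2 ≤ d) (B : SuBasis n) (shapes : Finset (PathWord d))
    (coef : PathWord d → ℂ) (ν₀ ν₁ : Fin d) (L : ℕ) [NeZero L] (k : ℕ)
    (U : GaugeConfig d L (Matrix.specialUnitaryGroup (Fin n) ℂ)) :
    loopSk hd B shapes coef ν₀ L k (WilsonFlow.coeConfig U) = loopSk hd B shapes coef ν₁ L k (WilsonFlow.coeConfig U) :=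
  IsLuscherSeries.coeConfig_eq_loopSk hd B shapes coef ν₁ L (isLuscherSeries_loopSk hd B shapes coef ν₀ L)
    (contDiff_loopSk hd B shapes coef ν₀ L) (isHaarNormalised_loopSk hd B shapes coef ν₀ L) k U

end

end Summit.Ventures.LatticeQCDFlow.TrivializingMaps
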